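import Literature.Probability.LatticeModels.ProdBernoulliIndependence
import HarnessLib

/-!
# Superposition of independent product Bernoulli configurations

Topic `Literature/Probability/LatticeModels`; proofs-only companion of
`Literature.Probability.LatticeModels.prodBernoulli` (`IsoradialPercolation.lean`).

**Superposition principle.** If `ξ ⊆ ι × {0,1}` is a `prodBernoulli P` sample (coordinate
`(i, j)` present independently with probability `P (i, j)`), then the projected configuration
`{i | (i,0) ∈ ξ ∨ (i,1) ∈ ξ}` — the union of the two independent layers — is a `prodBernoulli`
sample with parameters `1 - (1 - P(i,0)) (1 - P(i,1))` (`prodBernoulli_map_superpose`). For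
percolation with edge weights `p_e = 1 - exp(-β J_e)` this is the familiar fact that the union of
independent percolations with kernels `J₁`, `J₂` is percolation with kernel `J₁ + J₂`
(`1 - e^{-βJ₁} e^{-βJ₂} = 1 - e^{-β(J₁+J₂)}`), the starting point of Hutchcroft's hierarchical
decomposition `J = H_σ + R_σ` (Hutchcroft 2022, §2.1: "The union `ω` of the configuration `ω_R`
with all of the configurations `ω_B` is equal in distribution to long-range Bernoulli percolation
on `ℤ^d` with kernel `J`"). Modelling the layers as ONE product measure on `ι × Fin 2` (rather
than a product of two measures) keeps independence, Harris–FKG and BK available verbatim on the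
labelled configuration.

Proof: transport to Mathlib's `Measure.infinitePi` on `ι × Fin 2 → Prop`, curry
(`Measure.infinitePi_map_curry`), push the coordinatewise map `g ↦ g 0 ∨ g 1` through the outer
product (`Measure.infinitePi_map_pi`), and compute the two-coin law on `Fin 2 → Prop`
(`pi_bernoulli_map_or`).

## References

* T. Hutchcroft, *Sharp hierarchical upper bounds on the critical two-point function for
  long-range percolation on `ℤ^d`*, J. Math. Phys. 63 (2022), arXiv:2202.07634, §2.1 (p. 7).
* G. R. Grimmett, *Percolation*, 2nd ed., Springer 1999, §1.3 p. 10 (product measure).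
-/

noncomputable section

namespace Literature.Probability.LatticeModels

open MeasureTheory Measure ProbabilityTheory unitInterval
open scoped ENNReal

variable {ι : Type*}

/-- The superposed parameter: `σ (σ p * σ q) = 1 - (1 - p)(1 - q)` as a real number. [folklore] -/
theorem coe_symm_symm_mul_symm (p q : unitInterval) :
    ((σ (σ p * σ q) : unitInterval) : ℝ) = 1 - (1 - (p : ℝ)) * (1 - (q : ℝ)) := by
  rw [coe_symm_eq, Set.Icc.coe_mul, coe_symm_eq, coe_symm_eq]

/-- Two probability measures on `Prop` that agree on `{False}` are equal (private copy of
`Literature.Probability.Percolation.measure_prop_ext`, `SprinkledCoupling.lean`, to keep the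
imports light). [folklore] -/
private theorem measure_prop_ext' {μ ν : Measure Prop} [IsProbabilityMeasure μ] [IsProbabilityMeasure ν]
    (h : μ {False} = ν {False}) : μ = ν := by
  refine Measure.ext_of_singleton fun a => ?_
  rcases Classical.em a with ha | ha
  · obtain rfl : a = True := eq_true ha
    have hc : ({True} : Set Prop) = {False}ᶜ := by
      ext r; by_cases hr : r <;> simp [hr]
    rw [hc, prob_compl_eq_one_sub (measurableSet_singleton False),
      prob_compl_eq_one_sub (measurableSet_singleton False), h]
  · obtain rfl : a = False := eq_false ha
    exact h

/-- **The two-coin computation**: if `g 0`, `g 1` are independent coins showing `True` with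
probabilities `p 0`, `p 1`, then `g 0 ∨ g 1` shows `True` with probability
`1 - (1 - p 0)(1 - p 1)`. [folklore] -/
theorem pi_bernoulli_map_or (p : Fin 2 → unitInterval) :
    (Measure.pi fun j : Fin 2 => Ber(True, False, p j)).map (fun g : Fin 2 → Prop => g 0 ∨ g 1) =
      Ber(True, False, σ (σ (p 0) * σ (p 1))) := by
  have hmeas : Measurable (fun g : Fin 2 → Prop => g 0 ∨ g 1) := measurable_of_countable _
  haveI : IsProbabilityMeasure
      ((Measure.pi fun j : Fin 2 => Ber(True, False, p j)).map
        (fun g : Fin 2 → Prop => g 0 ∨ g 1)) :=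
    isProbabilityMeasure_map hmeas.aemeasurable
  refine measure_prop_ext' ?_
  rw [Measure.map_apply hmeas (measurableSet_singleton False)]
  have hpre : (fun g : Fin 2 → Prop => g 0 ∨ g 1) ⁻¹' {False} =
      Set.pi Set.univ (fun _ : Fin 2 => ({False} : Set Prop)) := by
    ext g
    simp only [Set.mem_preimage, Set.mem_singleton_iff, eq_iff_iff, iff_false, not_or,
      Set.mem_pi, Set.mem_univ, forall_const, Fin.forall_fin_two]
  rw [hpre, Measure.pi_pi, Fin.prod_univ_two, bernoulliMeasure_prop_apply_false,
    bernoulliMeasure_prop_apply_false, bernoulliMeasure_prop_apply_false,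
    ← ENNReal.ofReal_mul (sub_nonneg.2 (p 0).2.2), coe_symm_symm_mul_symm]
  congr 1
  ring

/-- **Superposition of the two layers of a product Bernoulli configuration on `ι × {0,1}`.**
Under `prodBernoulli P` on `Set (ι × Fin 2)`, the projected configuration
`{i | (i,0) ∈ ξ ∨ (i,1) ∈ ξ}` has law `prodBernoulli (i ↦ 1 - (1 - P(i,0))(1 - P(i,1)))`: the
union of two independent product Bernoulli configurations with parameters `p`, `q` is a product
Bernoulli configuration with parameters `1 - (1-p)(1-q)` (for `p = 1 - e^{-βJ₁}`,
`q = 1 - e^{-βJ₂}` this is `1 - e^{-β(J₁+J₂)}`: "the union … is equal in distribution to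
long-range Bernoulli percolation with kernel `J`", Hutchcroft 2022, §2.1).
[cite: Hutchcroft2022, §2.1 (p. 7)] -/
theorem prodBernoulli_map_superpose (P : ι × Fin 2 → unitInterval) :
    (prodBernoulli P).map (fun ξ : Set (ι × Fin 2) => {i | (i, 0) ∈ ξ ∨ (i, 1) ∈ ξ}) =
      prodBernoulli (fun i => σ (σ (P (i, 0)) * σ (P (i, 1)))) := by
  -- the three measurable maps: curry, coordinatewise `or`, and `setOf`
  have hor : Measurable (fun g : Fin 2 → Prop => g 0 ∨ g 1) := measurable_of_countable _
  have hpi : Measurable (fun (h : ι → Fin 2 → Prop) (i : ι) => h i 0 ∨ h i 1) :=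
    measurable_pi_lambda _ fun i => hor.comp (measurable_pi_apply i)
  have hset : Measurable (fun q : ι → Prop => {i | q i}) := measurable_setOf
  have hproj : Measurable (fun ξ : Set (ι × Fin 2) => {i | (i, 0) ∈ ξ ∨ (i, 1) ∈ ξ}) := by
    refine measurable_set_iff.2 fun i => ?_
    exact (measurable_set_mem (i, (0 : Fin 2))).or (measurable_set_mem (i, (1 : Fin 2)))
  -- factor the projection through `ι × Fin 2 → Prop`
  have hcomp : (fun ξ : Set (ι × Fin 2) => {i | (i, 0) ∈ ξ ∨ (i, 1) ∈ ξ}) ∘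
      (fun q : ι × Fin 2 → Prop => {k | q k}) =
        (fun q : ι → Prop => {i | q i}) ∘ (fun (h : ι → Fin 2 → Prop) (i : ι) => h i 0 ∨ h i 1) ∘
          (MeasurableEquiv.curry ι (Fin 2) Prop) := by
    funext q
    simp [MeasurableEquiv.coe_curry, Function.curry]
  have hcur : Measurable (MeasurableEquiv.curry ι (Fin 2) Prop) := MeasurableEquiv.measurable _
  rw [prodBernoulli_eq_map P, Measure.map_map hproj measurable_setOf, hcomp,
    ← Measure.map_map hset (hpi.comp hcur), ← Measure.map_map hpi hcur]
  -- curry the product over `ι × Fin 2`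
  have hcurry : (Measure.infinitePi fun k : ι × Fin 2 =>
      (toNNReal (P k) • Measure.dirac True + toNNReal (σ (P k)) • Measure.dirac False :
        Measure Prop)).map (MeasurableEquiv.curry ι (Fin 2) Prop) =
      Measure.infinitePi fun i : ι => Measure.infinitePi fun j : Fin 2 => Ber(True, False, P (i, j)) :=
    Measure.infinitePi_map_curry (fun (i : ι) (j : Fin 2) => Ber(True, False, P (i, j)))
  -- push the coordinatewise `or` through the outer product
  have hpush : (Measure.infinitePi fun i : ι =>
      Measure.infinitePi fun j : Fin 2 => Ber(True, False, P (i, j))).map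
        (fun (h : ι → Fin 2 → Prop) (i : ι) => h i 0 ∨ h i 1) =
      Measure.infinitePi fun i : ι =>
        (Measure.infinitePi fun j : Fin 2 => Ber(True, False, P (i, j))).map
          (fun g : Fin 2 → Prop => g 0 ∨ g 1) :=
    Measure.infinitePi_map_pi _ (fun _ => hor)
  rw [hcurry, hpush, prodBernoulli_eq_map]
  congr 1
  congrm Measure.infinitePi fun i => ?_
  rw [Measure.infinitePi_eq_pi]
  exact pi_bernoulli_map_or fun j => P (i, j)

/-- Applied form of `prodBernoulli_map_superpose`: probabilities of events about the superposed
configuration. [cite: Hutchcroft2022, §2.1 (p. 7)] -/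
theorem prodBernoulli_real_preimage_superpose (P : ι × Fin 2 → unitInterval) {S : Set (Set ι)}
    (hS : MeasurableSet S) :
    (prodBernoulli P).real ((fun ξ : Set (ι × Fin 2) => {i | (i, 0) ∈ ξ ∨ (i, 1) ∈ ξ}) ⁻¹' S) =
      (prodBernoulli (fun i => σ (σ (P (i, 0)) * σ (P (i, 1))))).real S := by
  have hproj : Measurable (fun ξ : Set (ι × Fin 2) => {i | (i, 0) ∈ ξ ∨ (i, 1) ∈ ξ}) :=
    measurable_set_iff.2 fun i =>
      (measurable_set_mem (i, (0 : Fin 2))).or (measurable_set_mem (i, (1 : Fin 2)))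
  rw [measureReal_def, measureReal_def, ← Measure.map_apply hproj hS, prodBernoulli_map_superpose]

/-- **The law of one layer**: under `prodBernoulli P` on `Set (ι × Fin 2)`, the layer
`{i | (i, j) ∈ ξ}` is a `prodBernoulli (i ↦ P (i, j))` sample. [folklore] -/
theorem prodBernoulli_map_layer (P : ι × Fin 2 → unitInterval) (j : Fin 2) :
    (prodBernoulli P).map (fun ξ : Set (ι × Fin 2) => {i | (i, j) ∈ ξ}) =
      prodBernoulli (fun i => P (i, j)) := by
  have hev : Measurable (fun g : Fin 2 → Prop => g j) := measurable_pi_apply j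
  have hpi : Measurable (fun (h : ι → Fin 2 → Prop) (i : ι) => h i j) :=
    measurable_pi_lambda _ fun i => hev.comp (measurable_pi_apply i)
  have hset : Measurable (fun q : ι → Prop => {i | q i}) := measurable_setOf
  have hproj : Measurable (fun ξ : Set (ι × Fin 2) => {i | (i, j) ∈ ξ}) :=
    measurable_set_iff.2 fun i => measurable_set_mem (i, j)
  have hcomp : (fun ξ : Set (ι × Fin 2) => {i | (i, j) ∈ ξ}) ∘
      (fun q : ι × Fin 2 → Prop => {k | q k}) =
        (fun q : ι → Prop => {i | q i}) ∘ (fun (h : ι → Fin 2 → Prop) (i : ι) => h i j) ∘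
          (MeasurableEquiv.curry ι (Fin 2) Prop) := by
    funext q
    simp [MeasurableEquiv.coe_curry, Function.curry]
  have hcur : Measurable (MeasurableEquiv.curry ι (Fin 2) Prop) := MeasurableEquiv.measurable _
  rw [prodBernoulli_eq_map P, Measure.map_map hproj measurable_setOf, hcomp,
    ← Measure.map_map hset (hpi.comp hcur), ← Measure.map_map hpi hcur]
  have hcurry : (Measure.infinitePi fun k : ι × Fin 2 =>
      (toNNReal (P k) • Measure.dirac True + toNNReal (σ (P k)) • Measure.dirac False :
        Measure Prop)).map (MeasurableEquiv.curry ι (Fin 2) Prop) =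
      Measure.infinitePi fun i : ι => Measure.infinitePi fun j : Fin 2 => Ber(True, False, P (i, j)) :=
    Measure.infinitePi_map_curry (fun (i : ι) (j : Fin 2) => Ber(True, False, P (i, j)))
  have hpush : (Measure.infinitePi fun i : ι =>
      Measure.infinitePi fun j' : Fin 2 => Ber(True, False, P (i, j'))).map
        (fun (h : ι → Fin 2 → Prop) (i : ι) => h i j) =
      Measure.infinitePi fun i : ι =>
        (Measure.infinitePi fun j' : Fin 2 => Ber(True, False, P (i, j'))).map
          (fun g : Fin 2 → Prop => g j) :=
    Measure.infinitePi_map_pi _ (fun _ => hev)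
  rw [hcurry, hpush, prodBernoulli_eq_map]
  congr 1
  congrm Measure.infinitePi fun i => ?_
  exact Measure.infinitePi_map_eval _ j

end Literature.Probability.LatticeModels
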